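import Literature.NumberTheory.EllipticCurves.BinaryQuarticInvariantCountPrimePowerProofs
import Literature.NumberTheory.EllipticCurves.BinaryQuarticDiscriminantDensityProofs
import HarnessLib

/-!
# The `p`-adic mass of `{f ∈ V_{ℤ_p} : (I(f), J(f)) ≡ (I₀, J₀) (mod pᵏ)}` is `(1 − p⁻²)·p^{−2k}`
# over the good-reduction locus (Bhargava–Shankar, Prop. 5.12 / Props. 3.7–3.9)

`Proofs` companion (theorems only: no definitions, no named facts) of `BinaryQuarticForms.lean` and
`BinaryQuarticMeasure.lean` (the normalised Haar measure `μ_p = volume` on `V_{ℤ_p} = ℤ_p⁵`),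
combining the count `#{f ∈ V(ℤ/pᵏ) : (I,J) ≡ (I₀,J₀)} = (p³ − p)p^{3(k−1)}`
(`BinaryQuartic.natCard_invariants_zmod_primePow`, `BinaryQuarticInvariantCountPrimePowerProofs`)
with the measure `p^{−5k}` of a residue class of forms modulo `pᵏ`
(`BinaryQuartic.volume_setOf_map_toZModPow_eq`, `BinaryQuarticDiscriminantDensityProofs`).

Source and role. M. Bhargava, A. Shankar, *Binary quartic forms having bounded invariants, and the
boundedness of the average rank of elliptic curves*, Ann. of Math. (2) 181 (2015) 191–242: the
`p`-adic densities of §2.5 and the local masses of Prop. 5.12 of the held arXiv text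
`arXiv:1006.1002v2` (Props. 3.7–3.9 of the published version), where sets of `p`-adic forms
defined by conditions on the invariants are measured by `|1/27|_p · Vol(PGL₂(ℤ_p)) · ∫ … dI dJ`
with `Vol(PGL₂(ℤ_p)) = 1 − p⁻²`. Proved here, for every prime `p ≥ 5`, integers `I₀, J₀` with
`p ∤ 4I₀³ − J₀²` and `k ≥ 1`:

* `BinaryQuartic.padicInt_volume_setOf_invariants_congr`:
  **`μ_p{f ∈ V_{ℤ_p} : pᵏ ∣ I(f) − I₀, pᵏ ∣ J(f) − J₀} = (p³ − p)p^{3(k−1)} · p^{−5k}`** (`ℝ≥0∞`);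
* `BinaryQuartic.padicInt_volume_real_setOf_invariants_congr`: the same in `ℝ`,
  `= (1 − p⁻²) · p^{−2k}` — the invariant map pushes `μ_p` forward to `(1 − p⁻²)·dI dJ` over the
  locus `p ∤ 4I³ − J²`.

## References

* M. Bhargava, A. Shankar, Ann. of Math. (2) 181 (2015) 191–242 = arXiv:1006.1002, §2.5 and
  Prop. 5.12 of the arXiv v2 text (Props. 3.7–3.9 of the published version).
  [cite: BhargavaShankarAnnals2015, Prop. 5.12 (arXiv:1006.1002v2 numbering)]
-/

noncomputable section

open scoped Classical
open _root_.MeasureTheory Set Metric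
open scoped ENNReal

namespace Literature.NumberTheory.EllipticCurves

namespace BinaryQuartic

variable {p : ℕ} [hp : Fact p.Prime]

/-- A residue class of forms modulo `pᵏ` is measurable in `V_{ℤ_p}` (a product of closed balls in
the coefficients). [folklore] -/
theorem measurableSet_setOf_map_toZModPow (k : ℕ) (F : BinaryQuartic (ZMod (p ^ k))) :
    MeasurableSet {f : BinaryQuartic ℤ_[p] | f.map (PadicInt.toZModPow k) = F} := by
  have hset : {f : BinaryQuartic ℤ_[p] | f.map (PadicInt.toZModPow k) = F} =
      coeffs ⁻¹' Set.pi univ fun i => {x : ℤ_[p] | PadicInt.toZModPow k x = F.coeffs i} := by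
    ext f
    simp only [mem_setOf_eq, mem_preimage, mem_univ_pi]
    constructor
    · intro hf i
      rw [← coeffs_map, hf]
    · intro hf
      apply coeffs_injective
      funext i
      rw [coeffs_map]
      exact hf i
  rw [hset]
  refine measurable_coeffs (MeasurableSet.univ_pi fun i ↦ ?_)
  rw [setOf_toZModPow_eq]
  exact measurableSet_closedBall

/-- `pᵏ ∣ I(f) − I₀` iff `I(f mod pᵏ) = I₀` in `ℤ/pᵏ`. [folklore] -/
theorem pow_dvd_I_sub_iff (k : ℕ) (f : BinaryQuartic ℤ_[p]) (I₀ : ℤ) :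
    (p : ℤ_[p]) ^ k ∣ f.I - I₀ ↔ (f.map (PadicInt.toZModPow k)).I = I₀ := by
  rw [I_map, ← sub_eq_zero, ← _root_.map_intCast (PadicInt.toZModPow k) I₀, ← map_sub,
    ← RingHom.mem_ker, PadicInt.ker_toZModPow, Ideal.mem_span_singleton]

/-- `pᵏ ∣ J(f) − J₀` iff `J(f mod pᵏ) = J₀` in `ℤ/pᵏ`. [folklore] -/
theorem pow_dvd_J_sub_iff (k : ℕ) (f : BinaryQuartic ℤ_[p]) (J₀ : ℤ) :
    (p : ℤ_[p]) ^ k ∣ f.J - J₀ ↔ (f.map (PadicInt.toZModPow k)).J = J₀ := by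
  rw [J_map, ← sub_eq_zero, ← _root_.map_intCast (PadicInt.toZModPow k) J₀, ← map_sub,
    ← RingHom.mem_ker, PadicInt.ker_toZModPow, Ideal.mem_span_singleton]

/-- **The good-reduction `p`-adic mass** (Bhargava–Shankar, Prop. 5.12 / Props. 3.7–3.9, the case
of a residue class of invariants off `4I³ ≡ J² (mod p)`): for `p ≥ 5`, `p ∤ 4I₀³ − J₀²`, `k ≥ 1`,
`μ_p{f ∈ V_{ℤ_p} : pᵏ ∣ I(f) − I₀, pᵏ ∣ J(f) − J₀} = (p³ − p)p^{3(k−1)} · (p^{−k})⁵`.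
[cite: BhargavaShankarAnnals2015, Prop. 5.12 (arXiv:1006.1002v2 numbering)] -/
theorem padicInt_volume_setOf_invariants_congr (hp5 : 5 ≤ p) (I₀ J₀ : ℤ)
    (hIJ : ¬ (p : ℤ) ∣ 4 * I₀ ^ 3 - J₀ ^ 2) {k : ℕ} (hk : 1 ≤ k) :
    volume {f : BinaryQuartic ℤ_[p] | (p : ℤ_[p]) ^ k ∣ f.I - I₀ ∧ (p : ℤ_[p]) ^ k ∣ f.J - J₀} =
      (((p ^ 3 - p) * p ^ (3 * (k - 1)) : ℕ) : ℝ≥0∞) * (((p : ℝ≥0∞) ^ k)⁻¹) ^ 5 := by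
  set Z := (Finset.univ.filter fun F : BinaryQuartic (ZMod (p ^ k)) ↦
    F.I = (I₀ : ZMod (p ^ k)) ∧ F.J = (J₀ : ZMod (p ^ k))) with hZ
  have hS : {f : BinaryQuartic ℤ_[p] | (p : ℤ_[p]) ^ k ∣ f.I - I₀ ∧ (p : ℤ_[p]) ^ k ∣ f.J - J₀} =
      ⋃ F ∈ Z, {f | f.map (PadicInt.toZModPow k) = F} := by
    ext f
    simp only [mem_setOf_eq, mem_iUnion, hZ, Finset.mem_filter, Finset.mem_univ, true_and,
      exists_prop, exists_eq_right', pow_dvd_I_sub_iff, pow_dvd_J_sub_iff]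
  have hcard : Z.card = (p ^ 3 - p) * p ^ (3 * (k - 1)) := by
    rw [← natCard_invariants_zmod_primePow hp5 I₀ J₀ hIJ hk, Nat.card_eq_fintype_card,
      Fintype.card_subtype, hZ]
  rw [hS, measure_biUnion_finset, Finset.sum_congr rfl fun F _ ↦ volume_setOf_map_toZModPow_eq k F,
    Finset.sum_const, nsmul_eq_mul, hcard]
  · intro F _ G _ hFG
    rw [Function.onFun, Set.disjoint_left]
    intro f hfF hfG
    exact hFG (hfF.symm.trans hfG)
  · intro F _
    exact measurableSet_setOf_map_toZModPow k F

/-- **The good-reduction `p`-adic mass, real form: `μ_p{f : (I,J) ≡ (I₀,J₀) (mod pᵏ)} =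
(1 − p⁻²) · p^{−2k}`** — the push-forward of `μ_p` under the invariant map is `(1 − p⁻²)·dI dJ` off
`4I³ ≡ J² (mod p)` (`(1 − p⁻²) = Vol(PGL₂(ℤ_p))`). [cite: BhargavaShankarAnnals2015, Prop. 5.12 (arXiv:1006.1002v2 numbering)] -/
theorem padicInt_volume_real_setOf_invariants_congr (hp5 : 5 ≤ p) (I₀ J₀ : ℤ)
    (hIJ : ¬ (p : ℤ) ∣ 4 * I₀ ^ 3 - J₀ ^ 2) {k : ℕ} (hk : 1 ≤ k) :
    (volume {f : BinaryQuartic ℤ_[p] |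
      (p : ℤ_[p]) ^ k ∣ f.I - I₀ ∧ (p : ℤ_[p]) ^ k ∣ f.J - J₀}).toReal =
      (1 - 1 / (p : ℝ) ^ 2) / (p : ℝ) ^ (2 * k) := by
  rw [padicInt_volume_setOf_invariants_congr hp5 I₀ J₀ hIJ hk, ENNReal.toReal_mul,
    ENNReal.toReal_pow, ENNReal.toReal_inv, ENNReal.toReal_pow, ENNReal.toReal_natCast,
    ENNReal.toReal_natCast]
  have hp0 : (p : ℝ) ≠ 0 := by exact_mod_cast hp.out.ne_zero
  have hp1 : 1 ≤ p := hp.out.one_lt.le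
  obtain ⟨j, rfl⟩ : ∃ j, k = j + 1 := ⟨k - 1, by omega⟩
  rw [Nat.add_sub_cancel, Nat.cast_mul, Nat.cast_sub (Nat.le_self_pow (by norm_num) p),
    Nat.cast_pow, Nat.cast_pow]
  field_simp
  ring

end BinaryQuartic

end Literature.NumberTheory.EllipticCurves

end
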